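import Mathlib
import HarnessLib
import Literature.MathematicalPhysics.QuantumLattice.GrassmannLineDeterminantGram
import Summits.HubbardSuperconductivity.HubbardSuperconductivity.Theorems.KLProgrammeKLRegimeWickTwoCopyKernel

/-!
# Route `KLProgramme` — ENGINE child gen 6 (stmt-HubbardSuperconductivity-20236 `KLRegimeEngineV16`), `stub_engine_step_values` (E2-v10):
# the `k`-line two-vertex term WITHOUT FACTORIAL LOSS — antisymmetrisation into line determinants, Gram–Hadamard on the loop lines,
# Laplace expansion along the explicit lines (cell gate-hubbard-kl, seat p5 g5; E2-WICK-ROADMAP §5 (iv), HOME/prover-p5/E5-GAIN-SCALE-N.md)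

p5 g4's bridge `norm_kernel_crossContract_le` (p504809) reads the `k`-line term `(Δ_×(C_{k−1})∘⋯∘Δ_×(C_0))(a⁰·b¹)` line by line, with the
prefactor `(k+m₀)!(k+m₁)!/m!`; against the `(k!)⁻¹` of the exponential series (`klw_wickPairAmplitude_succ_lines`, p504266) this leaves
`k!·C(k+m₀,k)·C(k+m₁,k)·(m₀!m₁!/m!)`: the `k!` perfect matchings of the lines are counted with absolute values.  That is right for the E.5
classes `k = 3, 4` and not summable in `k` (the line-number sum runs to `|Γ × Fin 2| + 2`).  Here the matchings are resummed:

* `append_comp_perm`, **`kernel_append_comp_perm`** — the kernels of `b` are antisymmetric in a leading block of legs;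
* **`sum_mul_eq_inv_factorial_mul_sum_antisymm`** — a weight summed against an antisymmetric function may be antisymmetrised:
  `Σ_Y w(Y)·G(Y) = (n!)⁻¹ Σ_Y (Σ_σ sign σ · w(Y∘σ))·G(Y)`; `sum_sign_mul_prod_eq_det` — for `w(Y) = ∏_i c_i(X_i, Y_i)` the
  antisymmetrisation is the LINE DETERMINANT `det [c_i(X_i, Y_l)]_{i,l}`;
* **`sum_norm_det_mul_le_of_gram`** — THE HYBRID DEVICE: lines `0 … e−1` explicit, lines `e … k−1` with charged Gram data
  (`Literature.….norm_det_contr_le_of_gram`, p515367); for a permutation-symmetric weight `φ ≥ 0`,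
  `Σ_Y ‖det [L_i(X_i,Y_l)]‖·φ(Y) ≤ (k!/(k−e)!)·(Σ_s κ_s²)^{k−e}·Σ_Y (∏_{i<e} ‖L_i(X_i,Y_i)‖)·φ(Y)` (Laplace expansion along the explicit rows:
  `k!/(k−e)! ≤ k^e` terms, each reduced to the diagonal one by the symmetry of `φ`; Gram–Hadamard on the minor);
* **`norm_kernel_crossContract_le_gram`** — THE BRIDGE with `e` explicit lines:
  `‖kernel ((Δ_×(C_{k−1})∘⋯∘Δ_×(C_0))(a⁰·b¹)) m Z̃‖ ≤ ((k+m₀)!(k+m₁)!/(m!·(k−e)!))·(Σ_s κ_s²)^{k−e}·Σ_{X,Y} (∏_{i<e} ‖contr C_i (X i) (Y i)‖)·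
  ‖kernel a (k+m₀) (append X X₀)‖·‖kernel b (k+m₁) (append Y Y₁)‖` — p504809's shape on the first `e` lines (so p5 g4's sector-level device
  …CrossContractionSum/Sector/Norms/Sized/Value applies to them unchanged), the other `k − e` lines in a Gram minor; with `(k!)⁻¹` the prefactor is
  `C(k+m₀,k)·C(k+m₁,k)·(m₀!m₁!/m!)·k!/(k−e)!`, polynomial in `k` for fixed `e`.  The Gram legs of `b` are not sector-pinned (the determinant bound
  forgets the sector diagonality of the lines), so `b` is read at level `m₁ + e`; `e = 5 − m₁` keeps the top level of BGM (2.98).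

Generic (`𝕜 = ℝ, ℂ`, finite `Γ`); no definitions, no named facts, nothing about the model.  References (locators only): J. Feldman, H. Knörrer,
E. Trubowitz, Commun. Math. Phys. 247 (2004) App. B (Gram bounds); Rev. Math. Phys. 15 (2003) 1121–1169, §VI («overlapping loops»: explicit loop
lines extracted from the determinant); G. Benfatto, A. Giuliani, V. Mastropietro, Ann. Henri Poincaré 7 (2006) (2.79)–(2.80), Lemma 2.5 (2.98).
-/

noncomputable section

namespace Summit.HubbardSuperconductivity.HubbardSuperconductivity.Theorems.KLRegimeWick

set_option linter.dupNamespace false -- summit = problem name (single-conjunct summit), D-0017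

open Literature.MathematicalPhysics.QuantumLattice GrassmannAlgebra Finset Matrix
open scoped InnerProductSpace

/-! ## §1 Antisymmetry of the kernels in a leading block of legs -/

section Antisymm

variable {𝕜 : Type*} [RCLike 𝕜] {Γ : Type*}

/-- Permuting a leading block: `append (Y ∘ σ) W = append Y W ∘ σ̃` with `σ̃ = σ ⊕ 1` transported to `Fin (n + m)`. [folklore] -/
theorem append_comp_perm {α : Type*} {n m : ℕ} (Y : Fin n → α) (W : Fin m → α) (σ : Equiv.Perm (Fin n)) :
    Fin.append (Y ∘ σ) W = Fin.append Y W ∘ (finSumFinEquiv.permCongr (Equiv.Perm.sumCongr σ 1)) := by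
  funext i
  refine Fin.addCases (fun j => ?_) (fun j => ?_) i
  · simp only [Fin.append_left, Function.comp_apply, Equiv.permCongr_apply, finSumFinEquiv_symm_apply_castAdd,
      Equiv.Perm.sumCongr_apply, Sum.map_inl, finSumFinEquiv_apply_left]
  · simp only [Fin.append_right, Function.comp_apply, Equiv.permCongr_apply, finSumFinEquiv_symm_apply_natAdd,
      Equiv.Perm.sumCongr_apply, Sum.map_inr, Equiv.Perm.one_apply, finSumFinEquiv_apply_right]

/-- **The kernels are antisymmetric in a leading block of legs**: `kernel b (n+m) (append (Y ∘ σ) W) = sign σ · kernel b (n+m) (append Y W)`.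
[folklore] -/
theorem kernel_append_comp_perm (b : GrassmannAlgebra 𝕜 Γ) {n m : ℕ} (Y : Fin n → Γ) (W : Fin m → Γ) (σ : Equiv.Perm (Fin n)) :
    kernel 𝕜 b (n + m) (Fin.append (Y ∘ σ) W) = ((Equiv.Perm.sign σ : ℤ) : 𝕜) * kernel 𝕜 b (n + m) (Fin.append Y W) := by
  rw [append_comp_perm, kernel_comp_perm, Equiv.Perm.sign_permCongr, Equiv.Perm.sign_sumCongr, Equiv.Perm.sign_one, mul_one]

/-- `cons y (Y' ∘ σ) = cons y Y' ∘ σ̂` with `σ̂` fixing `0` and acting as `σ` on the successors. [folklore] -/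
theorem cons_comp_perm {α : Type*} {n : ℕ} (y : α) (Y' : Fin n → α) (σ : Equiv.Perm (Fin n)) :
    (Fin.cons y (Y' ∘ σ) : Fin (n + 1) → α) = (Fin.cons y Y' : Fin (n + 1) → α) ∘ (Equiv.Perm.decomposeFin.symm (0, σ)) := by
  funext i
  refine Fin.cases ?_ (fun x => ?_) i
  · simp only [Fin.cons_zero, Function.comp_apply, Equiv.Perm.decomposeFin_symm_apply_zero]
  · simp only [Fin.cons_succ, Function.comp_apply, Equiv.Perm.decomposeFin_symm_apply_succ, Equiv.swap_self, Equiv.refl_apply]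

variable [Fintype Γ]

/-- Re-indexing a sum over leg strings by a permutation of the slots. [folklore] -/
theorem sum_comp_perm_eq {M : Type*} [AddCommMonoid M] {n : ℕ} (d : Equiv.Perm (Fin n)) (F : (Fin n → Γ) → M) :
    ∑ Y : Fin n → Γ, F (Y ∘ d) = ∑ Y : Fin n → Γ, F Y :=
  Equiv.sum_comp (⟨fun Y => Y ∘ d, fun Y => Y ∘ d.symm, fun Y => funext fun i => by simp, fun Y => funext fun i => by simp⟩ :
    (Fin n → Γ) ≃ (Fin n → Γ)) F

/-- **Antisymmetrisation of a weight against an antisymmetric function**: if `G (Y ∘ σ) = sign σ · G Y` for all `σ`, then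
`Σ_Y w(Y)·G(Y) = (n!)⁻¹ · Σ_Y (Σ_σ sign σ · w(Y ∘ σ))·G(Y)`. [folklore] -/
theorem sum_mul_eq_inv_factorial_mul_sum_antisymm {n : ℕ} (w G : (Fin n → Γ) → 𝕜)
    (hG : ∀ (σ : Equiv.Perm (Fin n)) (Y : Fin n → Γ), G (Y ∘ σ) = ((Equiv.Perm.sign σ : ℤ) : 𝕜) * G Y) :
    ∑ Y, w Y * G Y = ((n.factorial : 𝕜))⁻¹ * ∑ Y, (∑ σ : Equiv.Perm (Fin n), ((Equiv.Perm.sign σ : ℤ) : 𝕜) * w (Y ∘ σ)) * G Y := by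
  have hσ : ∀ σ : Equiv.Perm (Fin n), ∑ Y, ((Equiv.Perm.sign σ : ℤ) : 𝕜) * w (Y ∘ σ) * G Y = ∑ Y, w Y * G Y := by
    intro σ
    have hterm : ∀ Y : Fin n → Γ, ((Equiv.Perm.sign σ : ℤ) : 𝕜) * w (Y ∘ σ) * G Y = w (Y ∘ σ) * G (Y ∘ σ) := by
      intro Y
      rw [hG σ Y]
      ring
    simp_rw [hterm]
    exact sum_comp_perm_eq σ fun Y => w Y * G Y
  have hn : ((n.factorial : 𝕜)) ≠ 0 := Nat.cast_ne_zero.2 (Nat.factorial_ne_zero n)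
  calc ∑ Y, w Y * G Y = ((n.factorial : 𝕜))⁻¹ * ∑ _σ : Equiv.Perm (Fin n), ∑ Y, w Y * G Y := by
        rw [sum_const, card_univ, Fintype.card_perm, Fintype.card_fin, nsmul_eq_mul, ← mul_assoc, inv_mul_cancel₀ hn, one_mul]
    _ = ((n.factorial : 𝕜))⁻¹ * ∑ Y, (∑ σ : Equiv.Perm (Fin n), ((Equiv.Perm.sign σ : ℤ) : 𝕜) * w (Y ∘ σ)) * G Y := by
        congr 1
        rw [sum_congr rfl fun σ _ => (hσ σ).symm, sum_comm]
        simp_rw [sum_mul]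

omit [Fintype Γ] in
/-- **The antisymmetrised product of line factors is the line determinant**: `Σ_σ sign σ · ∏_i M i (σ i) = det M`. [folklore] -/
theorem sum_sign_mul_prod_eq_det {n : ℕ} (M : Matrix (Fin n) (Fin n) 𝕜) :
    ∑ σ : Equiv.Perm (Fin n), ((Equiv.Perm.sign σ : ℤ) : 𝕜) * ∏ i, M i (σ i) = M.det := by
  calc ∑ σ : Equiv.Perm (Fin n), ((Equiv.Perm.sign σ : ℤ) : 𝕜) * ∏ i, M i (σ i)
      = ∑ σ : Equiv.Perm (Fin n), ((Equiv.Perm.sign σ : ℤ) : 𝕜) * ∏ i, M.transpose (σ i) i :=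
        sum_congr rfl fun σ _ => by simp only [Matrix.transpose_apply]
    _ = M.transpose.det := (Matrix.det_apply' _).symm
    _ = M.det := Matrix.det_transpose M

/-- **Antisymmetrisation into the line determinant**: for `b`'s kernels read on `n` contracted legs followed by `m₁` free legs,
`Σ_Y (∏_i c_i (X i) (Y i))·kernel b (n+m₁) (append Y Y₁) = (n!)⁻¹ · Σ_Y det [c_i (X i) (Y l)]·kernel b (n+m₁) (append Y Y₁)`. [folklore] -/
theorem sum_prod_mul_kernel_append_eq_sum_det {n m₁ : ℕ} (c : Fin n → Γ → Γ → 𝕜) (X : Fin n → Γ) (b : GrassmannAlgebra 𝕜 Γ)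
    (Y₁ : Fin m₁ → Γ) :
    ∑ Y : Fin n → Γ, (∏ i, c i (X i) (Y i)) * kernel 𝕜 b (n + m₁) (Fin.append Y Y₁) =
      ((n.factorial : 𝕜))⁻¹ * ∑ Y : Fin n → Γ, (Matrix.of fun i l => c i (X i) (Y l)).det * kernel 𝕜 b (n + m₁) (Fin.append Y Y₁) := by
  rw [sum_mul_eq_inv_factorial_mul_sum_antisymm _ _ fun σ Y => kernel_append_comp_perm b Y Y₁ σ]
  congr 1
  refine sum_congr rfl fun Y _ => ?_
  rw [← sum_sign_mul_prod_eq_det]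
  rfl

end Antisymm

/-! ## §2 The hybrid device: explicit lines `0 … e−1`, Gram lines `e … k−1` -/

section Hybrid

variable {𝕜 : Type*} [RCLike 𝕜] {E : Type*} [NormedAddCommGroup E] [InnerProductSpace 𝕜 E]
variable {Γ : Type*} [Fintype Γ] [DecidableEq Γ] {ι : Type*} [Fintype ι] [DecidableEq ι]

omit [DecidableEq Γ] in
/-- Sums over `k + 1`-strings split into head and tail. [folklore] -/
private theorem sum_pi_succ_eq_sum_sum_cons {A : Type*} [AddCommMonoid A] {k : ℕ} (F : (Fin (k + 1) → Γ) → A) :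
    ∑ Y : Fin (k + 1) → Γ, F Y = ∑ y : Γ, ∑ Y' : Fin k → Γ, F (Fin.cons y Y') := by
  rw [← Fintype.sum_prod_type']
  exact (Fintype.sum_equiv (Fin.consEquiv fun _ => Γ) _ _ fun q => rfl).symm

/-- **The hybrid device** (FKT's «overlapping loops» organisation: explicit loop lines extracted from the determinant, Gram–Hadamard on the
rest): lines `L_0 … L_{e−1}` arbitrary, lines `L_e … L_{k−1}` the two-point functions of charged covariances `C_{τ i}` with Gram data
`‖f‖, ‖g‖ ≤ κ`; then for every permutation-symmetric weight `φ ≥ 0` on the leg strings of `b`,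
`Σ_Y ‖det [L_i (X i) (Y l)]‖·φ(Y) ≤ (k!/(k−e)!)·(Σ_s κ_s²)^{k−e}·Σ_Y (∏_{i<e} ‖L_i (X i) (Y i)‖)·φ(Y)`.
[cite: FeldmanKnorrerTrubowitz2004, App. B] -/
theorem sum_norm_det_mul_le_of_gram (q : Γ → Bool) (C : ι → Matrix Γ Γ 𝕜) (hC : ∀ s X Y, q X = q Y → C s X Y = 0)
    (f g : ι → Γ → E) (κ : ι → ℝ) (hf : ∀ s X, q X = true → ‖f s X‖ ≤ κ s) (hg : ∀ s Y, q Y = false → ‖g s Y‖ ≤ κ s)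
    (hG : ∀ s X Y, q X = true → q Y = false → contr 𝕜 (C s) X Y = ⟪f s X, g s Y⟫_𝕜) :
    ∀ (e k : ℕ), e ≤ k → ∀ (L : Fin k → Γ → Γ → 𝕜) (τ : Fin k → ι),
      (∀ i : Fin k, e ≤ (i : ℕ) → ∀ X Y, L i X Y = contr 𝕜 (C (τ i)) X Y) →
      ∀ (X : Fin k → Γ) (φ : (Fin k → Γ) → ℝ), (∀ Y, 0 ≤ φ Y) → (∀ (σ : Equiv.Perm (Fin k)) (Y : Fin k → Γ), φ (Y ∘ σ) = φ Y) →
        ∑ Y : Fin k → Γ, ‖(Matrix.of fun i l => L i (X i) (Y l)).det‖ * φ Y ≤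
          ((k.factorial : ℝ) / (k - e).factorial) * (∑ s, κ s ^ 2) ^ (k - e) *
            ∑ Y : Fin k → Γ, (∏ i : Fin k, if (i : ℕ) < e then ‖L i (X i) (Y i)‖ else 1) * φ Y
  | 0, k, _, L, τ, hL, X, φ, hφ0, _ => by
    have hk : (0 : ℝ) < k.factorial := by exact_mod_cast Nat.factorial_pos k
    simp only [Nat.sub_zero, div_self hk.ne', one_mul, Nat.not_lt_zero, if_false, prod_const_one, one_mul, mul_sum]
    refine sum_le_sum fun Y _ => mul_le_mul_of_nonneg_right ?_ (hφ0 Y)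
    have hM : (Matrix.of fun i l => L i (X i) (Y l)) = Matrix.of fun i l => contr 𝕜 (C (τ i)) (X i) (Y l) := by
      ext i l
      exact hL i (Nat.zero_le _) _ _
    rw [hM]
    exact norm_det_contr_le_of_gram q C hC f g κ hf hg hG τ X Y
  | e + 1, k, hek, L, τ, hL, X, φ, hφ0, hφ => by
    obtain ⟨k', rfl⟩ : ∃ k', k = k' + 1 := ⟨k - 1, by omega⟩
    have hK0 : 0 ≤ ∑ s, κ s ^ 2 := sum_nonneg fun s _ => sq_nonneg (κ s)
    -- notation: the minor's lines
    set L' : Fin k' → Γ → Γ → 𝕜 := fun i => L i.succ with hL'def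
    have hL' : ∀ i : Fin k', e ≤ (i : ℕ) → ∀ X Y, L' i X Y = contr 𝕜 (C (τ i.succ)) X Y :=
      fun i hi X Y => hL i.succ (by rw [Fin.val_succ]; omega) X Y
    -- (1) Laplace expansion along row 0, norms, and the sum over `Y`
    have hlap : ∀ Y : Fin (k' + 1) → Γ, ‖(Matrix.of fun i l => L i (X i) (Y l)).det‖ ≤
        ∑ l : Fin (k' + 1), ‖L 0 (X 0) (Y l)‖ * ‖(Matrix.of fun i l' => L' i (X i.succ) ((Y ∘ l.succAbove) l')).det‖ := by
      intro Y
      rw [Matrix.det_succ_row_zero]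
      refine (norm_sum_le _ _).trans (sum_le_sum fun l _ => ?_)
      rw [norm_mul, norm_mul, norm_pow, norm_neg, norm_one, one_pow, one_mul]
      rfl
    have step1 : ∑ Y : Fin (k' + 1) → Γ, ‖(Matrix.of fun i l => L i (X i) (Y l)).det‖ * φ Y ≤
        ∑ l : Fin (k' + 1), ∑ Y : Fin (k' + 1) → Γ,
          ‖L 0 (X 0) (Y l)‖ * ‖(Matrix.of fun i l' => L' i (X i.succ) ((Y ∘ l.succAbove) l')).det‖ * φ Y := by
      rw [sum_comm]
      refine sum_le_sum fun Y _ => ?_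
      rw [← sum_mul]
      exact mul_le_mul_of_nonneg_right (hlap Y) (hφ0 Y)
    -- (2) every column `l` contributes the same as column `0` (symmetry of `φ`): re-index `Y ↦ Y ∘ cycleRange l`
    have step2 : ∀ l : Fin (k' + 1), ∑ Y : Fin (k' + 1) → Γ,
          ‖L 0 (X 0) (Y l)‖ * ‖(Matrix.of fun i l' => L' i (X i.succ) ((Y ∘ l.succAbove) l')).det‖ * φ Y =
        ∑ Y : Fin (k' + 1) → Γ, ‖L 0 (X 0) (Y 0)‖ * ‖(Matrix.of fun i l' => L' i (X i.succ) (Y l'.succ)).det‖ * φ Y := by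
      intro l
      rw [← sum_comp_perm_eq (Fin.cycleRange l)]
      refine sum_congr rfl fun Y _ => ?_
      have h0 : (Y ∘ Fin.cycleRange l) l = Y 0 := by rw [Function.comp_apply, Fin.cycleRange_self]
      have hs : ((Y ∘ Fin.cycleRange l) ∘ l.succAbove) = fun l' => Y l'.succ := by
        funext l'
        simp only [Function.comp_apply, Fin.cycleRange_succAbove]
      rw [h0, hs, hφ]
    -- (3) split `Y = cons y Y'` and apply the induction hypothesis to `φ_y = φ (cons y ·)`
    have step3 : ∑ Y : Fin (k' + 1) → Γ, ‖L 0 (X 0) (Y 0)‖ * ‖(Matrix.of fun i l' => L' i (X i.succ) (Y l'.succ)).det‖ * φ Y ≤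
        ((k'.factorial : ℝ) / (k' - e).factorial) * (∑ s, κ s ^ 2) ^ (k' - e) *
          ∑ Y : Fin (k' + 1) → Γ, (∏ i : Fin (k' + 1), if (i : ℕ) < e + 1 then ‖L i (X i) (Y i)‖ else 1) * φ Y := by
      rw [sum_pi_succ_eq_sum_sum_cons, sum_pi_succ_eq_sum_sum_cons
        (fun Y => (∏ i : Fin (k' + 1), if (i : ℕ) < e + 1 then ‖L i (X i) (Y i)‖ else 1) * φ Y), mul_sum]
      refine sum_le_sum fun y _ => ?_
      simp only [Fin.cons_zero, Fin.cons_succ]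
      have hih := sum_norm_det_mul_le_of_gram q C hC f g κ hf hg hG e k' (by omega) L' (fun i => τ i.succ) hL'
        (fun i => X i.succ) (fun Y' => φ (Fin.cons y Y')) (fun Y' => hφ0 _)
        (fun σ Y' => by rw [cons_comp_perm, hφ])
      calc ∑ Y' : Fin k' → Γ, ‖L 0 (X 0) y‖ * ‖(Matrix.of fun i l' => L' i (X i.succ) (Y' l')).det‖ * φ (Fin.cons y Y')
          = ‖L 0 (X 0) y‖ * ∑ Y' : Fin k' → Γ, ‖(Matrix.of fun i l' => L' i (X i.succ) (Y' l')).det‖ * φ (Fin.cons y Y') := by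
            rw [mul_sum]
            exact sum_congr rfl fun Y' _ => by ring
        _ ≤ ‖L 0 (X 0) y‖ * (((k'.factorial : ℝ) / (k' - e).factorial) * (∑ s, κ s ^ 2) ^ (k' - e) *
              ∑ Y' : Fin k' → Γ, (∏ i : Fin k', if (i : ℕ) < e then ‖L' i (X i.succ) (Y' i)‖ else 1) * φ (Fin.cons y Y')) :=
            mul_le_mul_of_nonneg_left hih (norm_nonneg _)
        _ = ((k'.factorial : ℝ) / (k' - e).factorial) * (∑ s, κ s ^ 2) ^ (k' - e) *
              ∑ Y' : Fin k' → Γ, (∏ i : Fin (k' + 1), if (i : ℕ) < e + 1 then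
                ‖L i (X i) ((Fin.cons y Y' : Fin (k' + 1) → Γ) i)‖ else 1) * φ (Fin.cons y Y') := by
            rw [mul_sum, mul_sum, mul_sum]
            refine sum_congr rfl fun Y' _ => ?_
            rw [Fin.prod_univ_succ]
            simp only [Fin.val_zero, Nat.zero_lt_succ, if_true, Fin.cons_zero, Fin.val_succ, Nat.succ_lt_succ_iff, Fin.cons_succ,
              hL'def]
            ring
    -- (4) assemble: `(k'+1) · k'!/(k'−e)! = (k'+1)!/((k'+1)−(e+1))!`
    have hfac : ((k' + 1 : ℕ) : ℝ) * ((k'.factorial : ℝ) / (k' - e).factorial) =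
        (((k' + 1).factorial : ℝ) / ((k' + 1) - (e + 1)).factorial) := by
      rw [Nat.factorial_succ, Nat.cast_mul, Nat.add_sub_add_right, mul_div_assoc]
    calc ∑ Y : Fin (k' + 1) → Γ, ‖(Matrix.of fun i l => L i (X i) (Y l)).det‖ * φ Y
        ≤ ∑ l : Fin (k' + 1), ∑ Y : Fin (k' + 1) → Γ,
            ‖L 0 (X 0) (Y l)‖ * ‖(Matrix.of fun i l' => L' i (X i.succ) ((Y ∘ l.succAbove) l')).det‖ * φ Y := step1
      _ = ((k' + 1 : ℕ) : ℝ) * ∑ Y : Fin (k' + 1) → Γ,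
            ‖L 0 (X 0) (Y 0)‖ * ‖(Matrix.of fun i l' => L' i (X i.succ) (Y l'.succ)).det‖ * φ Y := by
          rw [sum_congr rfl fun l _ => step2 l, sum_const, card_univ, Fintype.card_fin, nsmul_eq_mul]
      _ ≤ ((k' + 1 : ℕ) : ℝ) * (((k'.factorial : ℝ) / (k' - e).factorial) * (∑ s, κ s ^ 2) ^ (k' - e) *
            ∑ Y : Fin (k' + 1) → Γ, (∏ i : Fin (k' + 1), if (i : ℕ) < e + 1 then ‖L i (X i) (Y i)‖ else 1) * φ Y) :=
          mul_le_mul_of_nonneg_left step3 (Nat.cast_nonneg _)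
      _ = (((k' + 1).factorial : ℝ) / ((k' + 1) - (e + 1)).factorial) * (∑ s, κ s ^ 2) ^ (k' + 1 - (e + 1)) *
            ∑ Y : Fin (k' + 1) → Γ, (∏ i : Fin (k' + 1), if (i : ℕ) < e + 1 then ‖L i (X i) (Y i)‖ else 1) * φ Y := by
          rw [← hfac, Nat.add_sub_add_right]
          ring

end Hybrid

/-! ## §3 The bridge with `e` explicit lines and `k − e` Gram lines -/

section Bridge

variable {𝕜 : Type*} [RCLike 𝕜] {E : Type*} [NormedAddCommGroup E] [InnerProductSpace 𝕜 E]
variable {Γ : Type*} [Fintype Γ] [DecidableEq Γ] {ι : Type*} [Fintype ι] [DecidableEq ι]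

/-- **The `k`-line two-vertex term without factorial loss** (the bridge p504809 with the loop lines in a Gram minor): for covariances
`C₀ … C_{k−1}` of which `C_i`, `e ≤ i`, are members `Cg (τ i)` of a charged Gram family (`‖f‖, ‖g‖ ≤ κ`), and the sorting data of the doubled
output tuple `Z̃` (`m₀` legs of `a`, `m₁` legs of `b`, `exists_perm_block`),
`‖kernel ((Δ_×(C_{k−1})∘⋯∘Δ_×(C_0))(a⁰·b¹)) m Z̃‖ ≤ ((k+m₀)!(k+m₁)!/(m!·(k−e)!))·(Σ_s κ_s²)^{k−e}·
Σ_{X,Y : Fin k → Γ} (∏_{i<e} ‖contr C_i (X i) (Y i)‖)·‖kernel a (k+m₀) (append X X₀)‖·‖kernel b (k+m₁) (append Y Y₁)‖`.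
With the `(k!)⁻¹` of the exponential series the prefactor is `C(k+m₀,k)·C(k+m₁,k)·(m₀!m₁!/m!)·k!/(k−e)!` — no factorial in `k`.
[cite: FeldmanKnorrerTrubowitz2004, App. B] -/
theorem norm_kernel_crossContract_le_gram (q : Γ → Bool) (Cg : ι → Matrix Γ Γ 𝕜) (hCg : ∀ s X Y, q X = q Y → Cg s X Y = 0)
    (f g : ι → Γ → E) (κ : ι → ℝ) (hf : ∀ s X, q X = true → ‖f s X‖ ≤ κ s) (hg : ∀ s Y, q Y = false → ‖g s Y‖ ≤ κ s)
    (hG : ∀ s X Y, q X = true → q Y = false → contr 𝕜 (Cg s) X Y = ⟪f s X, g s Y⟫_𝕜)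
    {k e : ℕ} (he : e ≤ k) (C : Fin k → Matrix Γ Γ 𝕜) (τ : Fin k → ι) (hCτ : ∀ i : Fin k, e ≤ (i : ℕ) → C i = Cg (τ i))
    (a b : GrassmannAlgebra 𝕜 Γ) {m : ℕ} (Z : Fin m → Γ × Fin 2)
    {m₀ m₁ : ℕ} (h : m = m₁ + m₀) (σ : Equiv.Perm (Fin (m₁ + m₀))) (X₀ : Fin m₀ → Γ) (Y₁ : Fin m₁ → Γ)
    (hZ : (Z ∘ Fin.cast h.symm) ∘ σ = Fin.append (fun j => (Y₁ j, (1 : Fin 2))) (fun j => (X₀ j, (0 : Fin 2)))) :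
    ‖kernel 𝕜 (((List.ofFn fun i => grassmannLaplacian 𝕜 (crossCov 𝕜 (C i))).reverse).prod (dblCopy 𝕜 0 a * dblCopy 𝕜 1 b)) m Z‖ ≤
      (((k + m₀).factorial * (k + m₁).factorial : ℝ) / (m.factorial * (k - e).factorial)) * (∑ s, κ s ^ 2) ^ (k - e) *
        ∑ X : Fin k → Γ, ∑ Y : Fin k → Γ, (∏ i : Fin k, if (i : ℕ) < e then ‖contr 𝕜 (C i) (X i) (Y i)‖ else 1) *
          (‖kernel 𝕜 a (k + m₀) (Fin.append X X₀)‖ * ‖kernel 𝕜 b (k + m₁) (Fin.append Y Y₁)‖) := by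
  have hm₀ : (0 : ℝ) < m₀.factorial := by exact_mod_cast Nat.factorial_pos m₀
  have hm₁ : (0 : ℝ) < m₁.factorial := by exact_mod_cast Nat.factorial_pos m₁
  have hm : (0 : ℝ) < m.factorial := by exact_mod_cast Nat.factorial_pos m
  have hkf : (0 : ℝ) < k.factorial := by exact_mod_cast Nat.factorial_pos k
  have hke : (0 : ℝ) < (k - e).factorial := by exact_mod_cast Nat.factorial_pos (k - e)
  have hK0 : 0 ≤ ∑ s, κ s ^ 2 := sum_nonneg fun s _ => sq_nonneg (κ s)
  -- the exact `k`-fold contraction, summed over the legs `X` of `a` first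
  rw [crossLaplacian_listProd_copy_mul_copy, kernel_smul, norm_mul, norm_pow, norm_neg, norm_one, one_pow, one_mul, kernel_sum]
  refine (norm_sum_le _ _).trans ?_
  rw [Finset.mul_sum]
  refine Finset.sum_le_sum fun X _ => ?_
  -- linearity in `b`: the `Y`-sum enters the second copy
  set A : GrassmannAlgebra 𝕜 Γ := CliffordAlgebra.involute^[k] (iterDeriv 𝕜 X a) with hA
  set B : GrassmannAlgebra 𝕜 Γ := ∑ Y : Fin k → Γ, (∏ i, contr 𝕜 (C i) (X i) (Y i)) • iterDeriv 𝕜 Y b with hB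
  have hlin : ∑ Y : Fin k → Γ, (∏ i, contr 𝕜 (C i) (X i) (Y i)) • (dblCopy 𝕜 0 A * dblCopy 𝕜 1 (iterDeriv 𝕜 Y b)) =
      dblCopy 𝕜 0 A * dblCopy 𝕜 1 B := by
    rw [hB, map_sum, Finset.mul_sum]
    exact sum_congr rfl fun Y _ => by rw [map_smul, mul_smul_comm]
  rw [hlin, norm_kernel_copy_mul_copy A B Z h σ X₀ Y₁ hZ, hA, norm_kernel_involute_iterDeriv]
  -- the kernel of `B`: antisymmetrise into the line determinant
  have hkerB : kernel 𝕜 B m₁ Y₁ = (((k + m₁).factorial : 𝕜) / (m₁.factorial : 𝕜)) * (((k.factorial : 𝕜))⁻¹ *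
      ∑ Y : Fin k → Γ, (Matrix.of fun i l => contr 𝕜 (C i) (X i) (Y l)).det * kernel 𝕜 b (k + m₁) (Fin.append Y Y₁)) := by
    rw [hB, kernel_sum, ← sum_prod_mul_kernel_append_eq_sum_det, Finset.mul_sum]
    refine sum_congr rfl fun Y _ => ?_
    have hm₁' : ((m₁.factorial : 𝕜)) ≠ 0 := Nat.cast_ne_zero.2 (Nat.factorial_ne_zero m₁)
    have hf := factorial_mul_kernel_iterDeriv (R := 𝕜) Y Y₁ b
    rw [kernel_smul]
    field_simp
    linear_combination (∏ i, contr 𝕜 (C i) (X i) (Y i)) * hf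
  -- the hybrid device on the `Y`-sum with the symmetric weight `‖kernel b (append · Y₁)‖`
  have hdev := sum_norm_det_mul_le_of_gram q Cg hCg f g κ hf hg hG e k he (fun i X Y => contr 𝕜 (C i) X Y) τ
    (fun i hi X Y => by rw [hCτ i hi]) X (fun Y => ‖kernel 𝕜 b (k + m₁) (Fin.append Y Y₁)‖) (fun Y => norm_nonneg _)
    (fun σ' Y => by
      rw [kernel_append_comp_perm, norm_mul]
      rcases Int.units_eq_one_or (Equiv.Perm.sign σ') with h1 | h1 <;> simp [h1])
  have hnormB : ‖kernel 𝕜 B m₁ Y₁‖ ≤ (((k + m₁).factorial : ℝ) / m₁.factorial) * (((k.factorial : ℝ))⁻¹ *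
      (((k.factorial : ℝ) / (k - e).factorial) * (∑ s, κ s ^ 2) ^ (k - e) *
        ∑ Y : Fin k → Γ, (∏ i : Fin k, if (i : ℕ) < e then ‖contr 𝕜 (C i) (X i) (Y i)‖ else 1) *
          ‖kernel 𝕜 b (k + m₁) (Fin.append Y Y₁)‖)) := by
    rw [hkerB, norm_mul, norm_div, RCLike.norm_natCast, RCLike.norm_natCast, norm_mul, norm_inv, RCLike.norm_natCast]
    refine mul_le_mul_of_nonneg_left (mul_le_mul_of_nonneg_left ((norm_sum_le _ _).trans ?_) (inv_nonneg.2 hkf.le))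
      (div_nonneg (Nat.cast_nonneg _) (Nat.cast_nonneg _))
    refine le_trans (le_of_eq (sum_congr rfl fun Y _ => norm_mul _ _)) hdev
  -- assemble
  have hXa : 0 ≤ ((k + m₀).factorial : ℝ) * ‖kernel 𝕜 a (k + m₀) (Fin.append X X₀)‖ / m₀.factorial :=
    div_nonneg (mul_nonneg (Nat.cast_nonneg _) (norm_nonneg _)) hm₀.le
  calc ((m₀.factorial * m₁.factorial : ℝ) / m.factorial) *
        (((k + m₀).factorial : ℝ) * ‖kernel 𝕜 a (k + m₀) (Fin.append X X₀)‖ / m₀.factorial * ‖kernel 𝕜 B m₁ Y₁‖)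
      ≤ ((m₀.factorial * m₁.factorial : ℝ) / m.factorial) *
        (((k + m₀).factorial : ℝ) * ‖kernel 𝕜 a (k + m₀) (Fin.append X X₀)‖ / m₀.factorial *
          ((((k + m₁).factorial : ℝ) / m₁.factorial) * (((k.factorial : ℝ))⁻¹ *
            (((k.factorial : ℝ) / (k - e).factorial) * (∑ s, κ s ^ 2) ^ (k - e) *
              ∑ Y : Fin k → Γ, (∏ i : Fin k, if (i : ℕ) < e then ‖contr 𝕜 (C i) (X i) (Y i)‖ else 1) *
                ‖kernel 𝕜 b (k + m₁) (Fin.append Y Y₁)‖)))) :=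
        mul_le_mul_of_nonneg_left (mul_le_mul_of_nonneg_left hnormB hXa)
          (div_nonneg (mul_nonneg hm₀.le hm₁.le) hm.le)
    _ = (((k + m₀).factorial * (k + m₁).factorial : ℝ) / (m.factorial * (k - e).factorial)) * (∑ s, κ s ^ 2) ^ (k - e) *
        ∑ Y : Fin k → Γ, (∏ i : Fin k, if (i : ℕ) < e then ‖contr 𝕜 (C i) (X i) (Y i)‖ else 1) *
          (‖kernel 𝕜 a (k + m₀) (Fin.append X X₀)‖ * ‖kernel 𝕜 b (k + m₁) (Fin.append Y Y₁)‖) := by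
        rw [Finset.mul_sum, Finset.mul_sum, Finset.mul_sum, Finset.mul_sum, Finset.mul_sum, Finset.mul_sum]
        refine sum_congr rfl fun Y _ => ?_
        field_simp

end Bridge

end Summit.HubbardSuperconductivity.HubbardSuperconductivity.Theorems.KLRegimeWick

end
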